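import Summits.BirchSwinnertonDyer.BirchSwinnertonDyer.Theorems.EisensteinPrimesGoodLatticeBDPValueImprimLambdaLEOfFactsSurC
import Literature.NumberTheory.GaloisCohomology.TateGlobalEulerCharacteristicTotallyComplex
import HarnessLib

/-!
# Crux `GoodLatticeBDPValue` (stmt-BirchSwinnertonDyer-19032), line `halves`: THE CRUX BY NAME FROM EIGHT LITERATURE NAMED FACTS,
# Greenberg 2016 Prop. 2.6.3 CARRIED ONLY IN CASE (c) AT TOTALLY COMPLEX FIELDS — the by-name closure of the LEAD's skeleton v30

Cell `bsd-eis` (run/shared/lean/pub/bsd-eis/), LEAD seat `bsd-line-x1-p1` gen 9. `--supports stmt-BirchSwinnertonDyer-19032`.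

v29 (`…OfNamedFactsV29.goodLatticeBDPValue_of_namedFacts₂₉`): the crux BY NAME from 8 names — Milne ADT I 5.1 supplied by the tree theorem
`forall_tateGlobalEulerPoincareCharacteristic_of_isTotallyComplex` (lane TATE-EPC-TC). v30: the research name Greenberg 2016 Prop. 2.6.3
(`prop263_sur_of_crk`) is replaced by its CASE (c) AT A TOTALLY COMPLEX FIELD `prop263_sur_of_crk_caseC_tc` (Literature p696608; Greenberg 2010
Prop. 3.2.1 (c)) — the only case the line's consumers read (`K` imaginary quadratic, `Λ = R = ℤ_p⟦T⟧`, cofree `𝐃`, `𝓛` full at the split prime `𝔭`,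
`η = 𝔭`); the consumers were re-typed token for token (`…OfSurC`, width seat w5 gen 9: `bigRep_fullAt_SUR_ofSurC`, …, `indexInputs_of_textbook_ofSurC`,
`imprimLambdaLE_of_facts_ofSurC`, `prop125_residualPair_unrSelmer_corank_ge_of_facts_ofSurC`, and the composed `goodLatticeBDPValue_of_namedFacts₂₈_ofSurC`
on v28's other stub texts). Result: `goodLatticeBDPValue_of_namedFacts₃₀ : ⟨proofThm422 ∧ thm513_disc ∧ thm331 ∧ thmII64⟩ → thm222_anacong_goodLattice_of_fullDescentDatum →
prop411_selmer_isAlmostDivisible → ⟨prop263_sur_of_crk_caseC_tc ∧ thm212⟩ → Theses.EisensteinPrimes.GoodLatticeBDPValue` := `…₂₈_ofSurC` fed the Tate THEOREM.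
COUNT-NEUTRAL (8 names: research 7 + preprint-grade 1); the point is that road «SUR-Λ»'s end theorem `prop263_sur_of_crk_caseC_tc_holds` (w5 g9 memo; Greenberg 2010
§§2–3 over the tree's Poitou–Tate at totally complex fields; input D = sub-lane «PT-Ш-S-TC») then discharges name #9 with no consumer work (8 → 7).
HONEST FRAMING: CONDITIONAL on exactly these eight names; closes nothing by itself; no summit statement / BSD / Mazur MC / IMC2 / KY 2.2.2 is proved for any curve.
[claim: KellerYin2024, status: under-review]
[cite: KellerYin2024, Thm. 3.0.8 (IMC2), Thm. 1.4.1, Thms. 2.2.1–2.2.3] [cite: CastellaGrossiLeeSkinner2022, proof of Thm. 4.2.2, Thm. 5.1.3 with (disc), Thm. 2.1.2]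
[cite: BleherEtAl2020, §3.3 Thm. 3.3.1] [cite: deShalit1987, II.6.4 Theorem (i)] [cite: Greenberg2016Selmer, Prop. 4.1.1, Prop. 2.6.3 (c)] [cite: Greenberg2010, Prop. 3.2.1 (c)]
[cite: MilneADT2006, I Thm. 5.1] [cite: Harari2020, Thm. 17.13 (a), Cor. 17.14] [cite: Kriz2016, Thm. 3, Def. 31 (5), Thm. 34 (3), Thm. 35]
-/

noncomputable section

namespace Summit.BirchSwinnertonDyer.BirchSwinnertonDyer.Theorems.GoodLatticeBDPValueOfNamedFactsV30

open Literature.NumberTheory.EllipticCurves.CastellaGrossiLeeSkinner2022 Literature.NumberTheory.EllipticCurves.BCGKPST2020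
  Literature.NumberTheory.EllipticCurves.DeShalit1987 Literature.NumberTheory.EllipticCurves.KellerYin2024
  Literature.NumberTheory.IwasawaTheory.Greenberg2016

/-- **THE CRUX BY NAME — `Theses.EisensteinPrimes.GoodLatticeBDPValue` — from EIGHT LITERATURE NAMED FACTS (the v30 surface)**: stub 1 (CGLS 2022
proof of Thm. 4.2.2, Thm. 5.1.3 (disc); Bleher et al. 2020 Thm. 3.3.1; de Shalit 1987 II.6.4), stub 3a-A (`thm222_anacong_goodLattice_of_fullDescentDatum`,
preprint-grade), stub 4 (Greenberg 2016 Prop. 4.1.1), stub 4b (Greenberg 2016 Prop. 2.6.3 IN CASE (c) AT TOTALLY COMPLEX FIELDS; CGLS 2022 Thm. 2.1.2);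
Milne ADT I 5.1 and Harari 17.13 (a) enter as TREE THEOREMS at totally complex fields. Composition: width seat w5 gen 9's
`GoodLatticeBDPValueOfNamedFactsV28.goodLatticeBDPValue_of_namedFacts₂₈_ofSurC` fed `forall_tateGlobalEulerPoincareCharacteristic_of_isTotallyComplex`.
CONDITIONAL on exactly these eight names; closes nothing by itself; BSD is proved for no curve.
[claim: KellerYin2024, status: under-review]
[cite: KellerYin2024, Thm. 3.0.8 (IMC2)] [cite: Greenberg2016Selmer, Prop. 4.1.1, Prop. 2.6.3 (c)] [cite: Greenberg2010, Prop. 3.2.1 (c)] [cite: MilneADT2006, I Thm. 5.1] -/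
theorem goodLatticeBDPValue_of_namedFacts₃₀
    (stub_publishedFacts :
      proofThm422_exists_isBDPLFunction_isTorsion_charIdeal_dvd ∧
        thm513_exists_isBDPLFunction_valueAtOne_disc ∧
        thm331_rubin_exists_katzMeasure₂_pseudoIso_span_eq ∧
        thmII64_katzMeasure₂_functionalEquation)
    (stub_anacongOfFullDescentDatum : thm222_anacong_goodLattice_of_fullDescentDatum)
    (stub_publishedFactsGreenberg : prop411_selmer_isAlmostDivisible)
    (stub_publishedFactsMore : prop263_sur_of_crk_caseC_tc ∧ thm212_exists_isKatzLFunction) :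
    Summit.BirchSwinnertonDyer.BirchSwinnertonDyer.Theses.EisensteinPrimes.GoodLatticeBDPValue :=
  GoodLatticeBDPValueOfNamedFactsV28.goodLatticeBDPValue_of_namedFacts₂₈_ofSurC stub_publishedFacts stub_anacongOfFullDescentDatum
    ⟨stub_publishedFactsGreenberg, Literature.NumberTheory.GaloisCohomology.forall_tateGlobalEulerPoincareCharacteristic_of_isTotallyComplex⟩
    stub_publishedFactsMore

end Summit.BirchSwinnertonDyer.BirchSwinnertonDyer.Theorems.GoodLatticeBDPValueOfNamedFactsV30

end
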